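import Summits.QuantumFields.BalabanUV.T4Continuum.Support.NE3NestedBlockMeanJensen
import Summits.QuantumFields.BalabanUV.T4Continuum.Support.NE3CovariantLineSumGauge
import HarnessLib

/-!
# NE3NestedBlockMeanJensenHS (T⁴ programme, node NE3, route H♮ — row NE3-R2's K6 inputs in the Hilbert–Schmidt currency):
# THE NESTED-MEAN JENSEN WITH CONSTANT ONE, `Σ_z M^d·nhsNormSq (bmeanIterW L k W μ z) ≤ Σ_y nhsNormSq (μ y)`

Row NE3-R2 (unit `b2b-balaban-t4-ne3r2-p1`, gen 9; standing disprover of the NE3 owner's route H♮, disprover note D-ne3r2-g9-1,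
HOME/CLAIMS.log), companion of gen 8's `NE3NestedBlockMeanJensen` (p231639).  Self-finding F-ne3r2-g9-1: the K6 currency of the blueprint
`HOME/t4/b2b-balaban-t4-ne3-p1/g23/D-ne3p1-g23-1.md` is the normalised Hilbert–Schmidt one (`nhsNormSq`, `hsR`), and the route through the
operator-norm Jensen (`sum_nhsNormSq_bmeanIterW_le`: `… ≤ card n·Σ nhsNormSq μ`) pays a spurious `card n`.  Since `nhsNormSq` is a Hilbert
norm squared and the transports are unitary conjugations (HS isometries, `AveragingDeficitHSInner.nhsNormSq_Ad`), Cauchy–Schwarz for finite sums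
(`NE3CovariantLineSumCore.nhsNormSq_sum_le_card_mul`, module `NE3CovariantLineSumGauge`) gives the block Jensen DIRECTLY in the HS currency with constant ONE:
`nhsNormSq_bmeanW_le_mean` (one level: `nhsNormSq (bmeanW L W μ y) ≤ L^{−d}·Σ_r nhsNormSq (μ (L•y + r))`, unitary `W`, `L ≥ 1`);
   `nhsNormSq_bmeanIterW_le_mean` (nested, multi-level small-field class as in the companion: `≤ M^{−d}·Σ_{v∈[0,M)^d} nhsNormSq (μ (M•z+v))`,
   `M = L^{j+1}`); **`sum_nhsNormSq_bmeanIterW_le_one`**: `Σ_{z∈periodBox N} M^d·nhsNormSq (bmeanIterW L (j+1) W μ z) ≤ Σ_{y∈periodBox (M·N)} nhsNormSq (μ y)`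
   — the `card n`-free twin of the companion's `sum_nhsNormSq_bmeanIterW_le` (consumers: K6b-2a `NE3SlicePoincareRemainderComb`'s Jensen
   weight `√(Σ_z M^d·nhsNormSq (ψ z))` and K6-face `NE3CovariantFacePairings` (P1)–(P3) through `Ψ = Σ_z nhsNormSq (ψ z)`, at `ψ := bmeanIterW L k W ζ′`).
All [folklore]; 0 sorry; 0 def.

HONEST FRAMING.  Elementary bookkeeping on OUR lattice objects at ONE unitary background in the multi-level small-field class; nothing about
Bałaban's minimisers; (P♮)_W, (ML_w) at `W ≠ 1`, T-E_w and NE3 are NOT proved; spine PROVED 0∕9; finite T⁴ rung (B)+1 — NOT infinite volume,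
NOT mass gap, NOT BetaPertH, NOT Clay.  ABSOLUTE RULE kept: no printed sentence is a hypothesis (context only: [Balaban1985Averaging] (42) p. 23).
PLACEMENT: `Summits/QuantumFields/BalabanUV/`; imports accepted modules only; moves nothing.
HONEST DEPENDENCY: continuum YM on T⁴ ⇐ BetaPertH ∧ nine spine estimates (0/9 proved); BetaPertH ⇐ (D1) ∧ (D4) ∧ CAP+tail; G-an2-4 gates asym,
D1 and NE2/3/4.
-/

set_option autoImplicit false

open scoped BigOperators Matrix.Norms.L2Operator
open Finset

namespace Summit.QuantumFields.BalabanUV.T4Continuum.NE3NestedBlockMeanJensenHS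

open Literature.MathematicalPhysics.QuantumFieldTheory.Balaban1983to89
open B7Prop1Explicit B7Prop2Explicit
open T4AveragingDeficitWall (IsUnitaryCfg SmallField Ad)
open AveragingDeficitChartCalculus (cavg)
open AveragingDeficitTwoLevelPrep (prop1Radius)
open AveragingDeficitMultiLevelPrep (LevelSmall prop1Radius_nonneg)
open AveragingDeficitHSInner (nhsNormSq_smul nhsNormSq_Ad)
open NE3TangentCovariantTower (step_small)
open NE3CovariantBlockMean (bmeanW bmeanIterW bmeanIterW_succ bmeanIterW_zero)
open NE3BlockLineAverage (sum_univ_boxVec sum_periodBox_blocks)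
open NE3CovariantLineSumCore (nhsNormSq_sum_le_card_mul)
open T4AveragingDeficitWallBoundary (periodBox)
open MatrixNorms (nhsNormSq nhsNormSq_nonneg)

noncomputable section

variable {d : ℕ} {n : Type*} [Fintype n] [DecidableEq n]

/-! ## Jensen for the (nested) transported block mean in the HS currency, constant one -/

/-- **ONE LEVEL, HS CURRENCY**: for unitary `W` and `L ≥ 1`, `nhsNormSq (bmeanW L W μ y) ≤ L^{−d}·Σ_r nhsNormSq (μ (L•y + r))`
(Cauchy–Schwarz over the `L^d` transported copies; each transport is an HS isometry). [folklore] -/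
theorem nhsNormSq_bmeanW_le_mean [Nonempty n] {L : ℕ} (hL : 1 ≤ L) {W : Site d → Fin d → (Matrix n n ℂ)ˣ} (hWu : IsUnitaryCfg W)
    (mu : Site d → Matrix n n ℂ) (y : Site d) :
    nhsNormSq (bmeanW L W mu y) ≤ ((L : ℝ) ^ d)⁻¹ * ∑ r : Fin d → Fin L, nhsNormSq (mu ((L : ℤ) • y + boxVec L r)) := by
  unfold bmeanW
  have hLd : (0 : ℝ) < (L : ℝ) ^ d := by positivity
  have hcard : ((Finset.univ : Finset (Fin d → Fin L)).card : ℝ) = (L : ℝ) ^ d := by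
    rw [Finset.card_univ, Fintype.card_fun, Fintype.card_fin, Fintype.card_fin]; push_cast; ring
  have hcs := nhsNormSq_sum_le_card_mul (n := n) (Finset.univ : Finset (Fin d → Fin L))
    (fun r => (((L : ℝ) ^ d)⁻¹ : ℝ) • Ad (hol W ((L : ℤ) • y) (treeWord (boxVec L r))) (mu ((L : ℤ) • y + boxVec L r)))
  rw [hcard] at hcs
  have hterm : ∀ r : Fin d → Fin L,
      nhsNormSq ((((L : ℝ) ^ d)⁻¹ : ℝ) • Ad (hol W ((L : ℤ) • y) (treeWord (boxVec L r))) (mu ((L : ℤ) • y + boxVec L r)))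
        = (((L : ℝ) ^ d)⁻¹) ^ 2 * nhsNormSq (mu ((L : ℤ) • y + boxVec L r)) := by
    intro r
    rw [nhsNormSq_smul, nhsNormSq_Ad (hol_mem_of hWu _ _)]
  simp only [hterm] at hcs
  rw [← Finset.mul_sum] at hcs
  calc nhsNormSq (∑ r : Fin d → Fin L,
        (((L : ℝ) ^ d)⁻¹ : ℝ) • Ad (hol W ((L : ℤ) • y) (treeWord (boxVec L r))) (mu ((L : ℤ) • y + boxVec L r)))
      ≤ (L : ℝ) ^ d * ((((L : ℝ) ^ d)⁻¹) ^ 2 * ∑ r : Fin d → Fin L, nhsNormSq (mu ((L : ℤ) • y + boxVec L r))) := hcs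
    _ = ((L : ℝ) ^ d)⁻¹ * ∑ r : Fin d → Fin L, nhsNormSq (mu ((L : ℤ) • y + boxVec L r)) := by
        field_simp

/-- **NESTED, HS CURRENCY** (multi-level small-field class, `L ≥ 1`): `nhsNormSq (bmeanIterW L (j+1) W μ z) ≤ M^{−d}·Σ_{v∈[0,M)^d} nhsNormSq (μ (M•z+v))`,
`M = L^{j+1}` — one HS Jensen per level (`nhsNormSq_bmeanW_le_mean` at the unitary averaged backgrounds) and the composition of the flat weights
over the nested boxes (`sum_periodBox_blocks`), exactly as the companion's operator-norm `norm_bmeanIterW_le_mean`. [folklore] -/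
theorem nhsNormSq_bmeanIterW_le_mean [Nonempty n] {L : ℕ} (hL : 1 ≤ L) (j : ℕ) :
    ∀ {W : Site d → Fin d → (Matrix n n ℂ)ˣ} {x : ℝ}, IsUnitaryCfg W → 0 ≤ x → LevelSmall d L j x → SmallField W x →
    ∀ (mu : Site d → Matrix n n ℂ) (z : Site d),
      nhsNormSq (bmeanIterW L (j + 1) W mu z)
        ≤ (((L ^ (j + 1) : ℕ) : ℝ) ^ d)⁻¹ * ∑ v ∈ periodBox (d := d) (L ^ (j + 1)), nhsNormSq (mu (((L ^ (j + 1) : ℕ) : ℤ) • z + v)) := by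
  induction j with
  | zero =>
      intro W x hWu _ _ _ mu z
      rw [bmeanIterW_succ, bmeanIterW_zero]
      simp only [zero_add, pow_one]
      have h := nhsNormSq_bmeanW_le_mean (L := L) hL hWu mu z
      rw [← sum_univ_boxVec L (fun v => nhsNormSq (mu ((L : ℤ) • z + v)))]
      exact h
  | succ j ih =>
      intro W x hWu hx hsm hWx mu z
      obtain ⟨-, hW₁u, hr0, hW₁x⟩ := step_small hL hWu hx hsm.1 hWx
      rw [bmeanIterW_succ]
      have hI := ih hW₁u hr0 hsm.2 hW₁x (bmeanW L W mu) z
      have hKd : (0 : ℝ) ≤ (((L ^ (j + 1) : ℕ) : ℝ) ^ d)⁻¹ := by positivity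
      -- HS Jensen at the finest level, block by block
      have hblock : ∀ v ∈ periodBox (d := d) (L ^ (j + 1)),
          nhsNormSq (bmeanW L W mu (((L ^ (j + 1) : ℕ) : ℤ) • z + v))
            ≤ ((L : ℝ) ^ d)⁻¹ * ∑ r : Fin d → Fin L, nhsNormSq (mu ((L : ℤ) • (((L ^ (j + 1) : ℕ) : ℤ) • z + v) + boxVec L r)) :=
        fun v _ => nhsNormSq_bmeanW_le_mean hL hWu mu _
      -- the composition of the sub-block means
      have hcomp : ∑ v ∈ periodBox (d := d) (L ^ (j + 1)),
            ((L : ℝ) ^ d)⁻¹ * ∑ r : Fin d → Fin L, nhsNormSq (mu ((L : ℤ) • (((L ^ (j + 1) : ℕ) : ℤ) • z + v) + boxVec L r))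
          = ((L : ℝ) ^ d)⁻¹ * ∑ w ∈ periodBox (d := d) (L ^ (j + 1 + 1)), nhsNormSq (mu (((L ^ (j + 1 + 1) : ℕ) : ℤ) • z + w)) := by
        rw [← Finset.mul_sum, pow_succ' L (j + 1),
          ← sum_periodBox_blocks L (L ^ (j + 1)) hL (fun w => nhsNormSq (mu (((L * L ^ (j + 1) : ℕ) : ℤ) • z + w)))]
        congr 1
        refine Finset.sum_congr rfl fun v _ => ?_
        rw [sum_univ_boxVec L (fun u => nhsNormSq (mu ((L : ℤ) • (((L ^ (j + 1) : ℕ) : ℤ) • z + v) + u)))]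
        refine Finset.sum_congr rfl fun u _ => ?_
        congr 2
        rw [smul_add, smul_smul, add_assoc]
        push_cast
        rfl
      have hinv : (((L ^ (j + 1) : ℕ) : ℝ) ^ d)⁻¹ * (((L : ℝ) ^ d)⁻¹
            * ∑ w ∈ periodBox (d := d) (L ^ (j + 1 + 1)), nhsNormSq (mu (((L ^ (j + 1 + 1) : ℕ) : ℤ) • z + w)))
          = (((L ^ (j + 1 + 1) : ℕ) : ℝ) ^ d)⁻¹ * ∑ w ∈ periodBox (d := d) (L ^ (j + 1 + 1)), nhsNormSq (mu (((L ^ (j + 1 + 1) : ℕ) : ℤ) • z + w)) := by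
        push_cast
        rw [← mul_assoc, ← mul_inv, ← mul_pow]
        ring
      calc nhsNormSq (bmeanIterW L (j + 1) (cavg L W) (bmeanW L W mu) z)
          ≤ (((L ^ (j + 1) : ℕ) : ℝ) ^ d)⁻¹ * ∑ v ∈ periodBox (d := d) (L ^ (j + 1)), nhsNormSq (bmeanW L W mu (((L ^ (j + 1) : ℕ) : ℤ) • z + v)) := hI
        _ ≤ (((L ^ (j + 1) : ℕ) : ℝ) ^ d)⁻¹ * ∑ v ∈ periodBox (d := d) (L ^ (j + 1)),
              (((L : ℝ) ^ d)⁻¹ * ∑ r : Fin d → Fin L, nhsNormSq (mu ((L : ℤ) • (((L ^ (j + 1) : ℕ) : ℤ) • z + v) + boxVec L r))) :=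
            mul_le_mul_of_nonneg_left (Finset.sum_le_sum hblock) hKd
        _ = _ := by rw [hcomp, hinv]

/-- **THE NESTED MEAN IN K6's NORMALISED HILBERT–SCHMIDT CURRENCY, CONSTANT ONE** (same class; any `N`, no periodicity needed):
`Σ_{z∈[0,N)^d} M^d·nhsNormSq (bmeanIterW L (j+1) W μ z) ≤ Σ_{y∈[0,MN)^d} nhsNormSq (μ y)`, `M = L^{j+1}` — the `card n`-free twin of the companion's
`NE3NestedBlockMeanJensen.sum_nhsNormSq_bmeanIterW_le`. [folklore] -/
theorem sum_nhsNormSq_bmeanIterW_le_one [Nonempty n] {L : ℕ} (hL : 1 ≤ L) (j : ℕ) {W : Site d → Fin d → (Matrix n n ℂ)ˣ} {x : ℝ}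
    (hWu : IsUnitaryCfg W) (hx : 0 ≤ x) (hsm : LevelSmall d L j x) (hWx : SmallField W x) (mu : Site d → Matrix n n ℂ) (N : ℕ) :
    ∑ z ∈ periodBox (d := d) N, ((L : ℝ) ^ (j + 1)) ^ d * nhsNormSq (bmeanIterW L (j + 1) W mu z)
      ≤ ∑ y ∈ periodBox (d := d) (L ^ (j + 1) * N), nhsNormSq (mu y) := by
  have hM1 : 1 ≤ L ^ (j + 1) := Nat.one_le_pow _ _ hL
  have hMr : ((L ^ (j + 1) : ℕ) : ℝ) = (L : ℝ) ^ (j + 1) := by push_cast; rfl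
  have hMpos : (0 : ℝ) < ((L : ℝ) ^ (j + 1)) ^ d := by positivity
  rw [← sum_periodBox_blocks (L ^ (j + 1)) N hM1 (fun y => nhsNormSq (mu y))]
  refine Finset.sum_le_sum fun z _ => ?_
  have h := nhsNormSq_bmeanIterW_le_mean hL j hWu hx hsm hWx mu z
  rw [hMr] at h
  calc ((L : ℝ) ^ (j + 1)) ^ d * nhsNormSq (bmeanIterW L (j + 1) W mu z)
      ≤ ((L : ℝ) ^ (j + 1)) ^ d * ((((L : ℝ) ^ (j + 1)) ^ d)⁻¹
          * ∑ v ∈ periodBox (d := d) (L ^ (j + 1)), nhsNormSq (mu (((L ^ (j + 1) : ℕ) : ℤ) • z + v))) :=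
        mul_le_mul_of_nonneg_left h hMpos.le
    _ = ∑ v ∈ periodBox (d := d) (L ^ (j + 1)), nhsNormSq (mu (((L ^ (j + 1) : ℕ) : ℤ) • z + v)) := by
        field_simp

end

end Summit.QuantumFields.BalabanUV.T4Continuum.NE3NestedBlockMeanJensenHS
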